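import Literature.MathematicalPhysics.QuantumFieldTheory.Balaban1983to89.T3Thresholds

/-!
# Route `RectangleDomination` (LINE 17 of seat `ym-r3-idea-2`; rung R3 of LADDER-YM = `T3YM3TorusStatement.YM3TorusSU2`, a
# RECORD rung — not d = 4, not the Clay statement) — THE SHALLOW ENGINE of the glue `HistoryTailOfRectanglesL`
# (support item stmt-QuantumFields-23867), part 1: real-analysis lemmas

The glue `RectangleTailL → ShallowRectangleDominationL → DeepWindowTailL → UnitScaleTilt.HistoryTailL` needs, at the SHALLOW
averaged heights `3j ≤ K` (depth `h = K − j ≥ 2j`), a per-plaquette tail of the BARE event `{θ_{b₀}(h) ≤ |Ū^{j}(∂p) − 1|}` with a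
LOG-SQUARE rate `C·β_h^A·exp(−c·(1 + log g_h⁻¹)²)` (the minimal input of the history-tail bookkeeping, see
✓`StretchedTailHistoryTailOfOrlicz`), obtained from the two cruxes by: the contrapositive of the deterministic domination at
`η = θ_{b₀}(h)/(2C₃(j+1))` (side condition `√(L^j)(j+1)η ≤ η₀` ⇐ `√(L^j)·θ_{b₀}(h) ≤ b₀(2p₀)^{p₀}e^{½−p₀}·γ^{1/4}` for `2j ≤ h`), a
union bound over the `≤ 288·L^{3m}R²β_h⁹` rectangles `(i ≤ j, x, μ, ν, a, b ≤ R L^j)`, and the rectangle tail at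
`t = η√(L^i/L^j)`, whose exponent `(c·t²β_K/((a+b)(1+log(a+b))))^α ≥ (c·c₂)^α(1+log g_h⁻¹)^{α(2p₀−3)}` dominates the log-square
rate once `α(2p₀ − 3) ≥ 2`.  This file holds the route-independent arithmetic (§1–§3) and the generic union-bound step (§4);
part 2 (`RectangleDominationShallowEngine.lean`) proves the shallow per-plaquette tail and the companion file
`RectangleDominationHistoryTailOfRectangles.lean` assembles the glue BY NAME.

HONEST FRAMING: bookkeeping only (real analysis + a union bound).  The cruxes `RectangleTailL` (stmt-23864),
`ShallowRectangleDominationL` (stmt-23865), `DeepWindowTailL` (stmt-22892) stay OPEN; nothing here proves `HistoryTailL`, the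
rung R3, or anything about the Yang–Mills mass gap.  No `def`, no `sorry`.

References: T. Bałaban, CMP **102** (1985) 255–275 [Balaban1985UV3] ((3),(7) p.256–257: `g_k`, `p(g) = b₀(1+log g⁻¹)^{p₀}`);
C. King, CMP **103** (1986) 323–349 [King1986] ((3.12): the free profile).
-/

set_option autoImplicit false

noncomputable section

open MeasureTheory
open scoped BigOperators
open Literature.MathematicalPhysics.QuantumFieldTheory.Balaban1983to89
open Literature.MathematicalPhysics.QuantumFieldTheory.Balaban1983to89.T3ContinuumYM3Torus
open Literature.MathematicalPhysics.QuantumFieldTheory.Balaban1983to89.T3UnitScaleTilt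
open Literature.MathematicalPhysics.QuantumFieldTheory.Balaban1983to89.T3Thresholds
open Literature.MathematicalPhysics.QuantumFieldTheory.Balaban1983to89.T3ThresholdSmallness (sqrt_coupling_pos_le)

namespace Summit.QuantumFields.YangMills.Theorems.RectangleDominationShallow

/-! ## §1 Arithmetic of the couplings `g_h = √(γL^{-h})` and inverse couplings `β_h = (γL^{-h})⁻¹` -/

section Coupling

variable {L : ℕ} {γ : ℝ}

/-- `L^h ≤ β_h = L^h/γ` for `0 < γ ≤ 1`. [cite: Balaban1985UV3, (3) p.256] -/
theorem pow_le_beta (hL : 1 ≤ L) (hγ : 0 < γ) (hγ1 : γ ≤ 1) (h : ℕ) :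
    (L : ℝ) ^ h ≤ (γ * ((L : ℝ)⁻¹) ^ h)⁻¹ := by
  have hL0 : (0 : ℝ) < L := by exact_mod_cast hL
  rw [mul_inv, inv_pow, inv_inv]
  exact le_mul_of_one_le_left (pow_nonneg hL0.le h) ((one_le_inv₀ hγ).mpr hγ1)

/-- `1 ≤ β_h` for `0 < γ ≤ 1`, `L ≥ 1`. [cite: Balaban1985UV3, (3) p.256] -/
theorem one_le_beta (hL : 1 ≤ L) (hγ : 0 < γ) (hγ1 : γ ≤ 1) (h : ℕ) :
    (1 : ℝ) ≤ (γ * ((L : ℝ)⁻¹) ^ h)⁻¹ :=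
  (one_le_pow₀ (by exact_mod_cast hL : (1 : ℝ) ≤ L)).trans (pow_le_beta hL hγ hγ1 h)

/-- `β_K = L^j · β_{K−j}` for `j ≤ K`. [cite: Balaban1985UV3, (3) p.256] -/
theorem beta_eq_pow_mul (hL : 1 ≤ L) (γ : ℝ) {K j : ℕ} (hj : j ≤ K) :
    (γ * ((L : ℝ)⁻¹) ^ K)⁻¹ = (L : ℝ) ^ j * (γ * ((L : ℝ)⁻¹) ^ (K - j))⁻¹ := by
  have hL0 : (L : ℝ) ≠ 0 := by positivity
  obtain ⟨h, rfl⟩ := Nat.exists_eq_add_of_le hj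
  rw [Nat.add_sub_cancel_left]
  simp only [mul_inv, inv_pow, inv_inv, pow_add]
  ring

/-- `β_K ≤ β_{K−j}²` in the shallow regime `2j ≤ K` (`0 < γ ≤ 1`). [cite: Balaban1985UV3, (3) p.256] -/
theorem beta_le_beta_sq (hL : 1 ≤ L) (hγ : 0 < γ) (hγ1 : γ ≤ 1) {K j : ℕ} (hj : 2 * j ≤ K) :
    (γ * ((L : ℝ)⁻¹) ^ K)⁻¹ ≤ ((γ * ((L : ℝ)⁻¹) ^ (K - j))⁻¹) ^ 2 := by
  have hL1 : (1 : ℝ) ≤ L := by exact_mod_cast hL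
  rw [beta_eq_pow_mul hL γ (by omega : j ≤ K), sq]
  refine mul_le_mul_of_nonneg_right ?_ (zero_le_one.trans (one_le_beta hL hγ hγ1 _))
  exact (pow_le_pow_right₀ hL1 (by omega : j ≤ K - j)).trans (pow_le_beta hL hγ hγ1 _)

/-- `L^j ≤ β_{K−j}` in the shallow regime `2j ≤ K` (`0 < γ ≤ 1`). [cite: Balaban1985UV3, (3) p.256] -/
theorem pow_le_beta_sub (hL : 1 ≤ L) (hγ : 0 < γ) (hγ1 : γ ≤ 1) {K j : ℕ} (hj : 2 * j ≤ K) :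
    (L : ℝ) ^ j ≤ (γ * ((L : ℝ)⁻¹) ^ (K - j))⁻¹ := by
  have hL1 : (1 : ℝ) ≤ L := by exact_mod_cast hL
  exact (pow_le_pow_right₀ hL1 (by omega : j ≤ K - j)).trans (pow_le_beta hL hγ hγ1 _)

/-- `L^j · g_h ≤ √γ` for `2j ≤ h` (`L ≥ 1`, `γ > 0`): the shallow heights see at most the unit-scale coupling.
[cite: Balaban1985UV3, (3) p.256] -/
theorem pow_mul_coupling_le (hL : 1 ≤ L) (hγ : 0 < γ) {j h : ℕ} (hjh : 2 * j ≤ h) :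
    (L : ℝ) ^ j * Real.sqrt (γ * ((L : ℝ)⁻¹) ^ h) ≤ Real.sqrt γ := by
  have hL1 : (1 : ℝ) ≤ L := by exact_mod_cast hL
  have hL0 : (0 : ℝ) < L := by linarith
  have hsq : (L : ℝ) ^ j = Real.sqrt (((L : ℝ) ^ j) ^ 2) := (Real.sqrt_sq (pow_nonneg hL0.le j)).symm
  rw [hsq, ← Real.sqrt_mul (sq_nonneg _)]
  refine Real.sqrt_le_sqrt ?_
  have hpow : (L : ℝ) ^ (2 * j) ≤ (L : ℝ) ^ h := pow_le_pow_right₀ hL1 hjh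
  have hh0 : (0 : ℝ) < (L : ℝ) ^ h := pow_pos hL0 h
  calc ((L : ℝ) ^ j) ^ 2 * (γ * ((L : ℝ)⁻¹) ^ h) = γ * ((L : ℝ) ^ (2 * j) / (L : ℝ) ^ h) := by
        rw [inv_pow, ← pow_mul, mul_comm 2 j]; ring
    _ ≤ γ * 1 := mul_le_mul_of_nonneg_left ((div_le_one hh0).mpr hpow) hγ.le
    _ = γ := mul_one γ

/-- `j·log L ≤ log g_h⁻¹` for `2j ≤ h`, `0 < γ ≤ 1`. [cite: Balaban1985UV3, (3) p.256] -/
theorem mul_log_le_log_inv (hL : 1 ≤ L) (hγ : 0 < γ) (hγ1 : γ ≤ 1) {j h : ℕ} (hjh : 2 * j ≤ h) :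
    (j : ℝ) * Real.log L ≤ Real.log (Real.sqrt (γ * ((L : ℝ)⁻¹) ^ h))⁻¹ := by
  have hL0 : (0 : ℝ) < L := by exact_mod_cast hL
  have hg := sqrt_coupling_pos_le hL hγ h
  rw [← Real.log_pow]
  refine Real.log_le_log (pow_pos hL0 j) ?_
  rw [inv_eq_one_div, le_div_iff₀ hg.1]
  exact (pow_mul_coupling_le hL hγ hjh).trans (Real.sqrt_le_one.mpr hγ1)

/-- A block size `L` which is odd and `> 1` is `≥ 3`. [folklore] -/
theorem three_le_of_odd (hL : Odd L ∧ 1 < L) : 3 ≤ L := by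
  obtain ⟨⟨k, hk⟩, h1⟩ := hL
  omega

/-- `1 ≤ log L` for `L ≥ 3` (`e < 3`). [folklore] -/
theorem one_le_log (hL : 3 ≤ L) : (1 : ℝ) ≤ Real.log L := by
  have hL' : (3 : ℝ) ≤ L := by exact_mod_cast hL
  rw [Real.le_log_iff_exp_le (by linarith)]
  have := Real.exp_one_lt_d9
  linarith

/-- `j ≤ log g_h⁻¹` for `2j ≤ h`, `0 < γ ≤ 1`, `L` odd `> 1` (so `log L ≥ 1`). [cite: Balaban1985UV3, (3) p.256] -/
theorem natCast_le_log_inv (hL : Odd L ∧ 1 < L) (hγ : 0 < γ) (hγ1 : γ ≤ 1) {j h : ℕ} (hjh : 2 * j ≤ h) :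
    (j : ℝ) ≤ Real.log (Real.sqrt (γ * ((L : ℝ)⁻¹) ^ h))⁻¹ :=
  (le_mul_of_one_le_right (Nat.cast_nonneg j) (one_le_log (three_le_of_odd hL))).trans
    (mul_log_le_log_inv hL.2.le hγ hγ1 hjh)

/-- `0 ≤ log g_h⁻¹` (`g_h ≤ 1` for `0 < γ ≤ 1`). [cite: Balaban1985UV3, (3) p.256] -/
theorem log_inv_coupling_nonneg (hL : 1 ≤ L) (hγ : 0 < γ) (hγ1 : γ ≤ 1) (h : ℕ) :
    0 ≤ Real.log (Real.sqrt (γ * ((L : ℝ)⁻¹) ^ h))⁻¹ :=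
  B10.log_inv_nonneg_of_le_one (sqrt_coupling_pos_le hL hγ h).1 (coupling_le_one hL hγ hγ1 h)

/-- `p_{1,1}(g) = 1 + log g⁻¹`: the log-square profile is Bałaban's `p`-function at `(b₀, p₀) = (1, 1)`.
[cite: Balaban1985UV3, (7) p.257] -/
theorem pFun_one_one (g : ℝ) : B10.pFun 1 1 g = 1 + Real.log g⁻¹ := by
  unfold B10.pFun
  rw [Real.rpow_one, one_mul]

end Coupling

/-! ## §2 The side condition of the shallow domination: `√(L^j)·θ_{b₀}(h) ≤ b₀(2p₀)^{p₀}e^{½−p₀}·γ^{1/4}` for `2j ≤ h` -/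

section Side

variable {L : ℕ} {γ b₀ p₀ : ℝ}

/-- **`√(L^j)·θ(h) ≤ b₀(2p₀)^{p₀}e^{½−p₀}·√√γ` for `2j ≤ h`** (`0 < γ ≤ 1`, `b₀ ≥ 0`, `p₀ > 0`): `θ(h) = g_h p(g_h) ≤ C_p√g_h`
(`T3Thresholds.gp_le_const_mul_sqrt`) and `L^j g_h ≤ √γ`. [cite: Balaban1985UV3, (7) p.257] -/
theorem sqrt_pow_mul_θBal_le (hL : 1 ≤ L) (hγ : 0 < γ) (hγ1 : γ ≤ 1) (hb : 0 ≤ b₀) (hp : 0 < p₀) {j h : ℕ}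
    (hjh : 2 * j ≤ h) :
    Real.sqrt ((L : ℝ) ^ j) * θBal L γ b₀ p₀ h ≤
      b₀ * ((2 * p₀) ^ p₀ * Real.exp (1 / 2 - p₀)) * Real.sqrt (Real.sqrt γ) := by
  have hL0 : (0 : ℝ) < L := by exact_mod_cast hL
  have hg := sqrt_coupling_pos_le hL hγ h
  have h1 : θBal L γ b₀ p₀ h ≤ b₀ * ((2 * p₀) ^ p₀ * Real.exp (1 / 2 - p₀)) *
      Real.sqrt (Real.sqrt (γ * ((L : ℝ)⁻¹) ^ h)) := by
    rw [θBal_eq]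
    exact gp_le_const_mul_sqrt hb hp hg.1 (coupling_le_one hL hγ hγ1 h)
  have hC : 0 ≤ b₀ * ((2 * p₀) ^ p₀ * Real.exp (1 / 2 - p₀)) := by positivity
  calc Real.sqrt ((L : ℝ) ^ j) * θBal L γ b₀ p₀ h
      ≤ Real.sqrt ((L : ℝ) ^ j) * (b₀ * ((2 * p₀) ^ p₀ * Real.exp (1 / 2 - p₀)) *
          Real.sqrt (Real.sqrt (γ * ((L : ℝ)⁻¹) ^ h))) := mul_le_mul_of_nonneg_left h1 (Real.sqrt_nonneg _)
    _ = b₀ * ((2 * p₀) ^ p₀ * Real.exp (1 / 2 - p₀)) *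
          Real.sqrt ((L : ℝ) ^ j * Real.sqrt (γ * ((L : ℝ)⁻¹) ^ h)) := by
        rw [Real.sqrt_mul (pow_nonneg hL0.le j)]; ring
    _ ≤ b₀ * ((2 * p₀) ^ p₀ * Real.exp (1 / 2 - p₀)) * Real.sqrt (Real.sqrt γ) :=
        mul_le_mul_of_nonneg_left (Real.sqrt_le_sqrt (pow_mul_coupling_le hL hγ hjh)) hC

/-- **ONE THRESHOLD FOR THE SIDE CONDITION**: for every `ε > 0` there is `γ_s ∈ (0, 1]` with `√(L^j)·θ_{b₀}(h) ≤ ε` for all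
`0 < γ ≤ γ_s`, all `L ≥ 1` and all `2j ≤ h` (`b₀, p₀ > 0`); explicitly `γ_s = min 1 ((ε/C_p)²)²`. [cite: Balaban1985UV3, (7) p.257] -/
theorem exists_gamma_sqrt_pow_mul_θBal_le (hb : 0 < b₀) (hp : 0 < p₀) {ε : ℝ} (hε : 0 < ε) :
    ∃ γs : ℝ, 0 < γs ∧ γs ≤ 1 ∧ ∀ (L : ℕ), 1 ≤ L → ∀ γ : ℝ, 0 < γ → γ ≤ γs →
      ∀ j h : ℕ, 2 * j ≤ h → Real.sqrt ((L : ℝ) ^ j) * θBal L γ b₀ p₀ h ≤ ε := by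
  set C := b₀ * ((2 * p₀) ^ p₀ * Real.exp (1 / 2 - p₀)) with hC_def
  have hC : 0 < C := by positivity
  refine ⟨min 1 (((ε / C) ^ 2) ^ 2), lt_min one_pos (by positivity), min_le_left _ _, ?_⟩
  intro L hL γ hγ hγs j h hjh
  have hγ1 : γ ≤ 1 := hγs.trans (min_le_left _ _)
  have hγσ : γ ≤ ((ε / C) ^ 2) ^ 2 := hγs.trans (min_le_right _ _)
  have hσC : 0 ≤ ε / C := div_nonneg hε.le hC.le
  have hsq : Real.sqrt (Real.sqrt γ) ≤ ε / C := by
    calc Real.sqrt (Real.sqrt γ) ≤ Real.sqrt (Real.sqrt (((ε / C) ^ 2) ^ 2)) :=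
          Real.sqrt_le_sqrt (Real.sqrt_le_sqrt hγσ)
      _ = ε / C := by rw [Real.sqrt_sq (sq_nonneg _), Real.sqrt_sq hσC]
  calc Real.sqrt ((L : ℝ) ^ j) * θBal L γ b₀ p₀ h ≤ C * Real.sqrt (Real.sqrt γ) :=
        sqrt_pow_mul_θBal_le hL hγ hγ1 hb.le hp hjh
    _ ≤ C * (ε / C) := mul_le_mul_of_nonneg_left hsq hC.le
    _ = ε := by field_simp

end Side

/-! ## §3 The exponent: the rectangle tail's stretched exponent dominates the log-square rate once `α(2p₀ − 3) ≥ 2` -/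

section Exponent

/-- Real-power algebra: `u^{2p₀−3} = (u^{p₀})²/u³` for `u > 0`. [folklore] -/
theorem rpow_two_mul_sub_three {u p₀ : ℝ} (hu : 0 < u) :
    u ^ (2 * p₀ - 3) = (u ^ p₀) ^ 2 / u ^ 3 := by
  rw [Real.rpow_sub hu, mul_comm, Real.rpow_mul hu.le, Real.rpow_two,
    show (3 : ℝ) = ((3 : ℕ) : ℝ) by norm_num, Real.rpow_natCast]

/-- **THE EXPONENT COMPARISON** (pure real analysis).  With `u = 1 + log g_h⁻¹ ≥ 1 + j`, `i·log L ≤ log g_h⁻¹`, a rectangle of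
perimeter `2 ≤ s = a + b ≤ R·L^i` and the threshold `t` with `t²β_K = (b₀u^{p₀})²·L^i/(4C₃²(j+1)²)`, the rectangle tail's
exponent `(c·t²β_K/(s(1 + log s)))^α` is at least `(c·c₂)^α·u²`, `c₂ = b₀²/(4C₃²R(1 + log R))`, provided `α(2p₀ − 3) ≥ 2`:
`s(1+log s) ≤ R L^i(1+log R)u`, `(j+1)² ≤ u²`, so the base is `≥ c₂u^{2p₀−3}`, and `u ≥ 1`. [cite: Balaban1985UV3, (7) p.257] -/
theorem logSq_le_exponent {α c C₃ R b₀ p₀ ℓ Li logL s : ℝ} {i j : ℕ} (hα : 0 < α) (hc : 0 < c) (hC₃ : 0 < C₃)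
    (hR : 2 ≤ R) (hb₀ : 0 < b₀) (hαp : 2 ≤ α * (2 * p₀ - 3)) (hℓ : 0 ≤ ℓ) (hjℓ : (j : ℝ) ≤ ℓ)
    (hiℓ : (i : ℝ) * logL ≤ ℓ) (hLi : 0 < Li) (hlogLi : Real.log Li = (i : ℝ) * logL) (hs2 : 2 ≤ s) (hsR : s ≤ R * Li) :
    (c * (b₀ ^ 2 / (4 * C₃ ^ 2 * R * (1 + Real.log R)))) ^ α * (1 + ℓ) ^ 2 ≤
      (c * ((b₀ * (1 + ℓ) ^ p₀) ^ 2 * Li / (4 * C₃ ^ 2 * ((j : ℝ) + 1) ^ 2) / (s * (1 + Real.log s)))) ^ α := by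
  -- notation
  have hu0 : 0 < 1 + ℓ := by linarith
  have hu1 : 1 ≤ 1 + ℓ := by linarith
  have hR0 : 0 < R := by linarith
  have hlogR : 0 ≤ Real.log R := Real.log_nonneg (by linarith)
  have hs0 : 0 < s := by linarith
  have hlogs0 : 0 ≤ Real.log s := Real.log_nonneg (by linarith)
  have hup : 0 < (1 + ℓ) ^ p₀ := Real.rpow_pos_of_pos hu0 p₀
  set D : ℝ := 4 * C₃ ^ 2 * R * (1 + Real.log R) with hD
  have hD0 : 0 < D := by positivity
  -- the denominator `s(1 + log s) ≤ R·Li·(1 + log R)·u`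
  have hlogs : Real.log s ≤ Real.log R + (i : ℝ) * logL := by
    have h1 : Real.log s ≤ Real.log (R * Li) := Real.log_le_log hs0 hsR
    rwa [Real.log_mul hR0.ne' hLi.ne', hlogLi] at h1
  have hden : s * (1 + Real.log s) ≤ R * Li * ((1 + Real.log R) * (1 + ℓ)) := by
    have h1 : 1 + Real.log s ≤ (1 + Real.log R) * (1 + ℓ) := by nlinarith
    exact mul_le_mul hsR h1 (by linarith) (by positivity)
  have hden0 : 0 < s * (1 + Real.log s) := by positivity
  -- the base is at least `c₂ u^{2p₀−3}`
  have hbase : b₀ ^ 2 / D * (1 + ℓ) ^ (2 * p₀ - 3) ≤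
      (b₀ * (1 + ℓ) ^ p₀) ^ 2 * Li / (4 * C₃ ^ 2 * ((j : ℝ) + 1) ^ 2) / (s * (1 + Real.log s)) := by
    have hj1 : ((j : ℝ) + 1) ^ 2 * (1 + ℓ) ≤ (1 + ℓ) ^ 3 := by
      have : ((j : ℝ) + 1) ^ 2 ≤ (1 + ℓ) ^ 2 := pow_le_pow_left₀ (by positivity) (by linarith) 2
      nlinarith
    have hj0 : 0 < ((j : ℝ) + 1) ^ 2 * (1 + ℓ) := by positivity
    calc b₀ ^ 2 / D * (1 + ℓ) ^ (2 * p₀ - 3)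
        = b₀ ^ 2 * ((1 + ℓ) ^ p₀) ^ 2 / (D * (1 + ℓ) ^ 3) := by
          rw [rpow_two_mul_sub_three hu0]; field_simp
      _ ≤ b₀ ^ 2 * ((1 + ℓ) ^ p₀) ^ 2 / (D * (((j : ℝ) + 1) ^ 2 * (1 + ℓ))) :=
          div_le_div_of_nonneg_left (by positivity) (by positivity) (mul_le_mul_of_nonneg_left hj1 hD0.le)
      _ = (b₀ * (1 + ℓ) ^ p₀) ^ 2 * Li / (4 * C₃ ^ 2 * ((j : ℝ) + 1) ^ 2) /
            (R * Li * ((1 + Real.log R) * (1 + ℓ))) := by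
          rw [hD]; field_simp
      _ ≤ (b₀ * (1 + ℓ) ^ p₀) ^ 2 * Li / (4 * C₃ ^ 2 * ((j : ℝ) + 1) ^ 2) / (s * (1 + Real.log s)) :=
          div_le_div_of_nonneg_left (by positivity) hden0 hden
  have hbase0 : 0 ≤ b₀ ^ 2 / D * (1 + ℓ) ^ (2 * p₀ - 3) :=
    mul_nonneg (div_nonneg (sq_nonneg _) hD0.le) (Real.rpow_nonneg hu0.le _)
  -- raise to the power `α`
  have hpow : (c * (b₀ ^ 2 / D * (1 + ℓ) ^ (2 * p₀ - 3))) ^ α ≤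
      (c * ((b₀ * (1 + ℓ) ^ p₀) ^ 2 * Li / (4 * C₃ ^ 2 * ((j : ℝ) + 1) ^ 2) / (s * (1 + Real.log s)))) ^ α :=
    Real.rpow_le_rpow (mul_nonneg hc.le hbase0) (mul_le_mul_of_nonneg_left hbase hc.le) hα.le
  refine le_trans ?_ hpow
  -- `(c c₂)^α u² ≤ (c c₂)^α u^{α(2p₀−3)} = (c·c₂·u^{2p₀−3})^α`
  have hsplit : (c * (b₀ ^ 2 / D * (1 + ℓ) ^ (2 * p₀ - 3))) ^ α =
      (c * (b₀ ^ 2 / D)) ^ α * (1 + ℓ) ^ ((2 * p₀ - 3) * α) := by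
    rw [← mul_assoc, Real.mul_rpow (by positivity) (Real.rpow_nonneg hu0.le _), ← Real.rpow_mul hu0.le]
  rw [hsplit]
  refine mul_le_mul_of_nonneg_left ?_ (Real.rpow_nonneg (by positivity) α)
  calc (1 + ℓ) ^ 2 = (1 + ℓ) ^ (2 : ℝ) := (Real.rpow_two _).symm
    _ ≤ (1 + ℓ) ^ ((2 * p₀ - 3) * α) := Real.rpow_le_rpow_of_exponent_le hu1 (by linarith)

end Exponent

/-! ## §4 The generic union-bound step -/

section Union

/-- **UNION BOUND WITH A UNIFORM TERM**: if `T ⊆ ⋃_{s ∈ S} E s` for a finite index set `S` and `μ(E s) ≤ B` for every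
`s ∈ S`, then `μ(T) ≤ #S · B` (finite measure, real-valued masses). [folklore] -/
theorem measureReal_le_card_mul {Ω ι : Type*} [MeasurableSpace Ω] (μ : Measure Ω) [IsFiniteMeasure μ]
    {T : Set Ω} (S : Finset ι) (E : ι → Set Ω) {B : ℝ} (hsub : T ⊆ ⋃ s ∈ S, E s)
    (hE : ∀ s ∈ S, μ.real (E s) ≤ B) : μ.real T ≤ S.card * B :=
  calc μ.real T ≤ μ.real (⋃ s ∈ S, E s) := measureReal_mono hsub (measure_ne_top _ _)
    _ ≤ ∑ s ∈ S, μ.real (E s) := measureReal_biUnion_finset_le S E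
    _ ≤ ∑ _s ∈ S, B := Finset.sum_le_sum hE
    _ = S.card * B := by rw [Finset.sum_const, nsmul_eq_mul]

end Union

end Summit.QuantumFields.YangMills.Theorems.RectangleDominationShallow

end
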